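import Mathlib
import HarnessLib

/-!
# [OURS · L1 W4.5(b)] Δ-centre toolkit D1 (i)–(ii) for the crux `EquisingularLiftNat` (EL♮,
# stmt-ResolutionOfSingularities-20038), line `sections`, research stub `stub_elnat_three`

NOT a statement of any manuscript. Helper file of the chain res-L1-w45b (CRUX-PLAN v3 §4, CHAIN v6 §3):
the typed signature candidates `DeltaFlat` / `DeltaSpecialFibre` of the planner's
`L/w45b/EL-NATURAL/DeltaCentreSignatures.lean` (sha16 `f3e4d5718baef2ab`, audited TRUE as typed by
res-L1-w45b-tri-1) are proved here BY SIGNATURE: the bodies of `deltaFlat` and `deltaSpecialFibre`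
below are the bodies of those two `def … : Prop` verbatim (so `theorem DeltaFlat_holds : DeltaFlat :=
deltaFlat` closes them once the defs are filed).

**The Δ-curve.** `O` a discrete valuation ring with uniformizer `ϖ`, `k = O/ϖ`, `A = O[x, y]`
(`MvPolynomial (Fin 2) O`). For a plane curve `D = V(ḡ) ⊂ 𝔸²_k` and a lift `g ∈ A` of `ḡ`, the centre
is `Δ_c := Spec A/(g + c·ϖ)` (`c ∈ O`; the planner takes `c` a unit).

* `deltaFlat` (D1 (i)): if `ḡ ≠ 0` then `A/(g + cϖ)` is `O`-flat. Proof: `k[x, y]` is a domain, so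
  `ϖ·h ∈ (g + cϖ)` forces `h ∈ (g + cϖ)` (`mem_span_delta_of_C_mul_mem`); hence every non-zero
  `r = vϖⁿ ∈ O` is a non-zero-divisor on the quotient, which is therefore torsion-free, and
  torsion-free modules over a Dedekind domain are flat (Mathlib `IsDedekindDomain.flat_iff_torsion_eq_bot`).
* `deltaSpecialFibre` (D1 (ii)): `(A/(g + cϖ))/(ϖ) ≃+* k[x, y]/(ḡ)` — the special fibre of the Δ-curve is
  the plane curve `D` (so condition E1 of EL♮ reads `D ⊆ Y′`). The isomorphism is produced by
  `exists_deltaSpecialFibreEquiv` (third isomorphism theorem `DoubleQuot.quotQuotEquivComm` and Mathlib's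
  `MvPolynomial.quotientEquivQuotientMvPolynomial`) together with its value on classes: the class of
  `p ∈ A` goes to the class of `p mod ϖ`. No hypothesis on `O`, `ϖ`, `g`, `c` is needed for (ii).
  (Stated as an `∃` with the computation rule so that this file stays definition-free.)

D1 (iii) `DeltaRegularGeneric` (regularity along the special fibre for all but finitely many residues
of `c`) is not in this file.
-/

set_option linter.dupNamespace false -- mandated namespace `Summit.<Summit>.<Problem>` of this single-conjunct summit
set_option linter.overlappingInstances false -- the audited signatures carry both [IsDomain O] and [IsDiscreteValuationRing O] (Mathlib's class takes the former as a parameter)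

namespace Summit.ResolutionOfSingularities.ResolutionOfSingularities.Cruxes.EquisingularLiftNat.Sections

open MvPolynomial

universe u

/-! ## D1 (i): flatness of the Δ-curve over the discrete valuation ring -/

section Flat

variable {O : Type u} [CommRing O]

/-- **Key cancellation.** If `(ϖ) ⊂ O` is prime and `ḡ := g mod ϖ ≠ 0` in `(O/ϖ)[x, y]`, then
`ϖ·h ∈ (g + cϖ)` implies `h ∈ (g + cϖ)` in `O[x, y]`: reducing `ϖh = q(g + cϖ)` mod `ϖ` gives `q̄ḡ = 0`,
so `q̄ = 0` (domain), `q = ϖq′`, and cancelling `ϖ` in the domain `O[x, y]` gives `h = q′(g + cϖ)`.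
[OURS · L1 W4.5b] helper for `deltaFlat`. -/
theorem mem_span_delta_of_C_mul_mem [IsDomain O] {ϖ : O} (hϖ : (Ideal.span {ϖ}).IsPrime)
    (hϖ0 : ϖ ≠ 0) {g : MvPolynomial (Fin 2) O}
    (hg : MvPolynomial.map (Ideal.Quotient.mk (Ideal.span {ϖ})) g ≠ 0) (c : O)
    {h : MvPolynomial (Fin 2) O} (hh : C ϖ * h ∈ Ideal.span {g + C (c * ϖ)}) :
    h ∈ Ideal.span {g + C (c * ϖ)} := by
  obtain ⟨q, hq⟩ := Ideal.mem_span_singleton'.mp hh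
  -- reduce modulo `ϖ`
  set red : MvPolynomial (Fin 2) O →+* MvPolynomial (Fin 2) (O ⧸ Ideal.span {ϖ}) :=
    MvPolynomial.map (Ideal.Quotient.mk (Ideal.span {ϖ})) with hred
  have hredϖ : red (C ϖ) = 0 := by
    rw [hred, map_C, Ideal.Quotient.eq_zero_iff_mem.mpr (Ideal.mem_span_singleton_self ϖ), C_0]
  have hredG : red (g + C (c * ϖ)) = red g := by
    rw [map_add, hred, map_C,
      Ideal.Quotient.eq_zero_iff_mem.mpr (Ideal.mul_mem_left _ c (Ideal.mem_span_singleton_self ϖ)),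
      C_0, add_zero]
  have hq0 : red q = 0 := by
    have h1 : red q * red g = 0 := by
      rw [← hredG, ← map_mul, hq, map_mul, hredϖ, zero_mul]
    rcases mul_eq_zero.mp h1 with h2 | h2
    · exact h2
    · exact absurd h2 hg
  -- hence `q = q′·ϖ`
  have hqmem : q ∈ Ideal.span {(C ϖ : MvPolynomial (Fin 2) O)} := by
    have hker : q ∈ RingHom.ker red := hq0
    rw [hred, MvPolynomial.ker_map, Ideal.mk_ker, Ideal.map_span, Set.image_singleton] at hker
    exact hker
  obtain ⟨q', rfl⟩ := Ideal.mem_span_singleton'.mp hqmem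
  -- cancel `ϖ` in the domain `O[x, y]`
  have hCϖ : (C ϖ : MvPolynomial (Fin 2) O) ≠ 0 := by
    rwa [Ne, MvPolynomial.C_eq_zero]
  have hh' : h = q' * (g + C (c * ϖ)) := by
    apply mul_left_cancel₀ hCϖ
    rw [← hq]
    ring
  exact Ideal.mem_span_singleton'.mpr ⟨q', hh'.symm⟩

/-- Iterate of `mem_span_delta_of_C_mul_mem`: `ϖⁿ·h ∈ (g + cϖ)` implies `h ∈ (g + cϖ)`.
[OURS · L1 W4.5b] helper for `deltaFlat`. -/
theorem mem_span_delta_of_C_pow_mul_mem [IsDomain O] {ϖ : O} (hϖ : (Ideal.span {ϖ}).IsPrime)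
    (hϖ0 : ϖ ≠ 0) {g : MvPolynomial (Fin 2) O}
    (hg : MvPolynomial.map (Ideal.Quotient.mk (Ideal.span {ϖ})) g ≠ 0) (c : O) (n : ℕ)
    {h : MvPolynomial (Fin 2) O} (hh : C (ϖ ^ n) * h ∈ Ideal.span {g + C (c * ϖ)}) :
    h ∈ Ideal.span {g + C (c * ϖ)} := by
  induction n generalizing h with
  | zero => simpa using hh
  | succ n ih =>
    apply mem_span_delta_of_C_mul_mem hϖ hϖ0 hg c
    apply ih
    have e : C (ϖ ^ (n + 1)) * h = C (ϖ ^ n) * (C ϖ * h) := by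
      rw [pow_succ, C_mul, mul_assoc]
    rw [e] at hh
    exact hh

/-- **The Δ-curve is torsion-free over the DVR**: for `O` a discrete valuation ring with uniformizer
`ϖ` and `ḡ ≠ 0`, no non-zero `r = vϖⁿ ∈ O` kills a non-zero class of `O[x, y]/(g + cϖ)`.
[OURS · L1 W4.5b] helper for `deltaFlat`. -/
theorem isTorsionFree_delta [IsDomain O] [IsDiscreteValuationRing O] {ϖ : O} (hϖ : Irreducible ϖ)
    {g : MvPolynomial (Fin 2) O}
    (hg : MvPolynomial.map (Ideal.Quotient.mk (Ideal.span {ϖ})) g ≠ 0) (c : O) :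
    Module.IsTorsionFree O (MvPolynomial (Fin 2) O ⧸ Ideal.span {g + C (c * ϖ)}) := by
  have hprime : (Ideal.span {ϖ}).IsPrime := (Ideal.span_singleton_prime hϖ.ne_zero).mpr hϖ.prime
  refine ⟨fun r hr => ?_⟩
  rw [isSMulRegular_iff_right_eq_zero_of_smul]
  intro m hm
  obtain ⟨h, rfl⟩ := Ideal.Quotient.mk_surjective m
  have hr0 : r ≠ 0 := hr.ne_zero
  obtain ⟨n, v, rfl⟩ := IsDiscreteValuationRing.eq_unit_mul_pow_irreducible hr0 hϖ
  -- `r • [h] = [r • h] = [C r · h]` (definitional unfolding of the quotient action)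
  have hm2 : Ideal.Quotient.mk (Ideal.span {g + C (c * ϖ)}) (((v : O) * ϖ ^ n) • h) = 0 := hm
  rw [smul_eq_C_mul, Ideal.Quotient.eq_zero_iff_mem, C_mul (a := (v : O)) (a' := ϖ ^ n),
    mul_assoc (C (v : O)) (C (ϖ ^ n)) h] at hm2
  have hm' : C (ϖ ^ n) * h ∈ Ideal.span {g + C (c * ϖ)} := by
    have h2 := Ideal.mul_mem_left _ (C ((v⁻¹ : Oˣ) : O)) hm2
    rwa [← mul_assoc, ← C_mul, Units.inv_mul, C_1, one_mul] at h2
  exact Ideal.Quotient.eq_zero_iff_mem.mpr (mem_span_delta_of_C_pow_mul_mem hprime hϖ.ne_zero hg c n hm')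

/-- **D1 (i) `DeltaFlat`, by signature** (planner's `DeltaCentreSignatures.lean` f3e4d5718baef2ab,
body verbatim): for a DVR `O` with uniformizer `ϖ`, a unit `u` and `g ∈ O[x, y]` with `ḡ ≠ 0`, the
Δ-curve `O[x, y]/(g + uϖ)` is flat over `O` (torsion-free by `isTorsionFree_delta`; torsion-free over a
Dedekind domain is flat, Mathlib). [OURS · L1 W4.5b] helper toward `stub_elnat_three`; NOT a statement
of the manuscript. -/
theorem deltaFlat :
    ∀ (O : Type) [CommRing O] [IsDomain O] [IsDiscreteValuationRing O] (ϖ : O), Irreducible ϖ →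
    ∀ (g : MvPolynomial (Fin 2) O) (u : Oˣ),
      MvPolynomial.map (Ideal.Quotient.mk (Ideal.span {ϖ})) g ≠ 0 →
      Module.Flat O (MvPolynomial (Fin 2) O ⧸ Ideal.span {g + C ((u : O) * ϖ)}) := by
  intro O _ _ _ ϖ hϖ g u hg
  haveI := isTorsionFree_delta hϖ hg (u : O)
  infer_instance

end Flat

/-! ## D1 (ii): the special fibre of the Δ-curve is the plane curve `V(ḡ)` -/

section SpecialFibre

variable {O : Type u} [CommRing O]

/-- Mathlib's `(O/K)[x, y] ≅ O[x, y]/K·O[x, y]`, inverted, on the class of a polynomial: reduce the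
coefficients. [folklore] (Re-proved here to keep imports light; the same computation is
`Literature.AlgebraicGeometry.Resolution.DeJong1996.AlgebraicNodeRing.quotientEquivQuotientMvPolynomial_symm_mk`.) -/
theorem quotientEquivQuotientMvPolynomial_symm_mk' {σ : Type*} (K : Ideal O) (q : MvPolynomial σ O) :
    (MvPolynomial.quotientEquivQuotientMvPolynomial K).symm (Ideal.Quotient.mk _ q) =
      MvPolynomial.map (Ideal.Quotient.mk K) q := by
  rw [AlgEquiv.symm_apply_eq]
  change ((Ideal.Quotient.mk (Ideal.map MvPolynomial.C K)) : MvPolynomial σ O →+* _) q =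
    ((MvPolynomial.quotientEquivQuotientMvPolynomial K).toAlgHom.toRingHom.comp
      (MvPolynomial.map (Ideal.Quotient.mk K))) q
  congr 1
  refine MvPolynomial.ringHom_ext (fun a => ?_) (fun j => ?_)
  · simp [MvPolynomial.quotientEquivQuotientMvPolynomial]
  · simp [MvPolynomial.quotientEquivQuotientMvPolynomial]

/-- In `O[x, y]/(g + cϖ)`, the ideal generated by the class of `ϖ` is the image of `ϖ·O[x, y]`
(written as the extension of `(ϖ) ⊂ O`). [OURS · L1 W4.5b] -/
theorem span_mk_C_eq_map_map (ϖ c : O) (g : MvPolynomial (Fin 2) O) :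
    Ideal.span {Ideal.Quotient.mk (Ideal.span {g + C (c * ϖ)}) (C ϖ : MvPolynomial (Fin 2) O)} =
      ((Ideal.span {ϖ}).map (C : O →+* MvPolynomial (Fin 2) O)).map
        (Ideal.Quotient.mk (Ideal.span {g + C (c * ϖ)})) := by
  rw [Ideal.map_span, Set.image_singleton, Ideal.map_span, Set.image_singleton]

/-- Modulo `ϖ`, the relation `g + cϖ` becomes `ḡ`: the image of `(g + cϖ)` in `(O/ϖ)[x, y]` (through
`O[x, y]/ϖ ≅ (O/ϖ)[x, y]`) is `(ḡ)`. [OURS · L1 W4.5b] -/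
theorem span_map_eq_map_map (ϖ c : O) (g : MvPolynomial (Fin 2) O) :
    Ideal.span {MvPolynomial.map (Ideal.Quotient.mk (Ideal.span {ϖ})) g} =
      (((Ideal.span {g + C (c * ϖ)}).map
        (Ideal.Quotient.mk ((Ideal.span {ϖ}).map (C : O →+* MvPolynomial (Fin 2) O)))).map
        ((MvPolynomial.quotientEquivQuotientMvPolynomial (σ := Fin 2) (Ideal.span {ϖ})).symm.toRingEquiv :
          _ →+* MvPolynomial (Fin 2) (O ⧸ Ideal.span {ϖ}))) := by
  rw [Ideal.map_span _ {g + C (c * ϖ)}, Set.image_singleton,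
    Ideal.map_span _ {Ideal.Quotient.mk _ (g + C (c * ϖ))}, Set.image_singleton]
  congr 2
  change _ = (MvPolynomial.quotientEquivQuotientMvPolynomial (σ := Fin 2) (Ideal.span {ϖ})).symm
    (Ideal.Quotient.mk _ (g + C (c * ϖ)))
  rw [quotientEquivQuotientMvPolynomial_symm_mk' (Ideal.span {ϖ}) (g + C (c * ϖ)), map_add, map_C,
    Ideal.Quotient.eq_zero_iff_mem.mpr (Ideal.mul_mem_left _ c (Ideal.mem_span_singleton_self ϖ)),
    C_0, add_zero]

/-- **The special fibre of the Δ-curve**: an isomorphism `(O[x, y]/(g + cϖ))/(ϖ) ≃+* (O/ϖ)[x, y]/(ḡ)`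
sending the class of `p ∈ O[x, y]` to the class of `p mod ϖ` — the composite of the third isomorphism
theorem `DoubleQuot.quotQuotEquivComm` with Mathlib's `MvPolynomial.quotientEquivQuotientMvPolynomial`.
No hypothesis on `O`, `ϖ`, `g`, `c`. [OURS · L1 W4.5b] helper toward `stub_elnat_three`; NOT a statement
of the manuscript. -/
theorem exists_deltaSpecialFibreEquiv (ϖ c : O) (g : MvPolynomial (Fin 2) O) :
    ∃ e : ((MvPolynomial (Fin 2) O ⧸ Ideal.span {g + C (c * ϖ)}) ⧸
        Ideal.span {Ideal.Quotient.mk (Ideal.span {g + C (c * ϖ)}) (C ϖ : MvPolynomial (Fin 2) O)}) ≃+*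
      (MvPolynomial (Fin 2) (O ⧸ Ideal.span {ϖ}) ⧸
        Ideal.span {MvPolynomial.map (Ideal.Quotient.mk (Ideal.span {ϖ})) g}),
      ∀ p : MvPolynomial (Fin 2) O,
        e (Ideal.Quotient.mk _ (Ideal.Quotient.mk _ p)) =
          Ideal.Quotient.mk _ (MvPolynomial.map (Ideal.Quotient.mk (Ideal.span {ϖ})) p) := by
  refine ⟨(Ideal.quotEquivOfEq (span_mk_C_eq_map_map ϖ c g)).trans
    ((DoubleQuot.quotQuotEquivComm (Ideal.span {g + C (c * ϖ)})
        ((Ideal.span {ϖ}).map (C : O →+* MvPolynomial (Fin 2) O))).trans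
      (Ideal.quotientEquiv _ _
        (MvPolynomial.quotientEquivQuotientMvPolynomial (σ := Fin 2) (Ideal.span {ϖ})).symm.toRingEquiv
        (span_map_eq_map_map ϖ c g))), fun p => ?_⟩
  rw [← quotientEquivQuotientMvPolynomial_symm_mk' (Ideal.span {ϖ}) p]
  rfl

/-- **D1 (ii) `DeltaSpecialFibre`, by signature** (planner's `DeltaCentreSignatures.lean`
f3e4d5718baef2ab, body verbatim): the special fibre of the Δ-curve `O[x, y]/(g + uϖ)` over the DVR
`O` is the plane curve `(O/ϖ)[x, y]/(ḡ)` (witness: `exists_deltaSpecialFibreEquiv`, with its value on classes). [OURS · L1 W4.5b] helper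
toward `stub_elnat_three`; NOT a statement of the manuscript. -/
theorem deltaSpecialFibre :
    ∀ (O : Type) [CommRing O] [IsDomain O] [IsDiscreteValuationRing O] (ϖ : O), Irreducible ϖ →
    ∀ (g : MvPolynomial (Fin 2) O) (u : Oˣ),
      letI A := MvPolynomial (Fin 2) O
      letI I : Ideal A := Ideal.span {g + C ((u : O) * ϖ)}
      Nonempty (((A ⧸ I) ⧸ Ideal.span {Ideal.Quotient.mk I (C ϖ : A)}) ≃+*
        (MvPolynomial (Fin 2) (O ⧸ Ideal.span {ϖ}) ⧸
          Ideal.span {MvPolynomial.map (Ideal.Quotient.mk (Ideal.span {ϖ})) g})) := by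
  intro O _ _ _ ϖ _ g u
  obtain ⟨e, -⟩ := exists_deltaSpecialFibreEquiv ϖ (u : O) g
  exact ⟨e⟩

end SpecialFibre


/-! ## Flatness of an arbitrary hypersurface over the DVR (any number of variables)

The cancellation argument of `mem_span_delta_of_C_mul_mem` uses neither the shape `g + cϖ` nor the
number of variables: for ANY `G ∈ O[x_σ]` with non-zero reduction `Ḡ`, the hypersurface ring
`O[x_σ]/(G)` is torsion-free, hence flat, over the DVR `O` (useful for the chain's specimens, e.g.
`V(x₀²x₃ − x₁²x₂) ⊂ ℙ³_O`, and for `E`-adapted equations). -/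

section FlatGeneral

variable {O : Type u} [CommRing O] {σ : Type*}

/-- If `(ϖ) ⊂ O` is prime and `Ḡ ≠ 0` in `(O/ϖ)[x_σ]`, then `ϖ·h ∈ (G)` implies `h ∈ (G)` in `O[x_σ]`.
[folklore] [OURS · L1 W4.5b] -/
theorem mem_span_singleton_of_C_mul_mem_of_map_ne_zero [IsDomain O] {ϖ : O}
    (hϖ : (Ideal.span {ϖ}).IsPrime) (hϖ0 : ϖ ≠ 0) {G : MvPolynomial σ O}
    (hG : MvPolynomial.map (Ideal.Quotient.mk (Ideal.span {ϖ})) G ≠ 0)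
    {h : MvPolynomial σ O} (hh : C ϖ * h ∈ Ideal.span {G}) : h ∈ Ideal.span {G} := by
  obtain ⟨q, hq⟩ := Ideal.mem_span_singleton'.mp hh
  set red : MvPolynomial σ O →+* MvPolynomial σ (O ⧸ Ideal.span {ϖ}) :=
    MvPolynomial.map (Ideal.Quotient.mk (Ideal.span {ϖ})) with hred
  have hredϖ : red (C ϖ) = 0 := by
    rw [hred, map_C, Ideal.Quotient.eq_zero_iff_mem.mpr (Ideal.mem_span_singleton_self ϖ), C_0]
  have hq0 : red q = 0 := by
    have h1 : red q * red G = 0 := by rw [← map_mul, hq, map_mul, hredϖ, zero_mul]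
    rcases mul_eq_zero.mp h1 with h2 | h2
    · exact h2
    · exact absurd h2 hG
  have hqmem : q ∈ Ideal.span {(C ϖ : MvPolynomial σ O)} := by
    have hker : q ∈ RingHom.ker red := hq0
    rw [hred, MvPolynomial.ker_map, Ideal.mk_ker, Ideal.map_span, Set.image_singleton] at hker
    exact hker
  obtain ⟨q', rfl⟩ := Ideal.mem_span_singleton'.mp hqmem
  have hCϖ : (C ϖ : MvPolynomial σ O) ≠ 0 := by rwa [Ne, MvPolynomial.C_eq_zero]
  have hh' : h = q' * G := by
    apply mul_left_cancel₀ hCϖ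
    rw [← hq]
    ring
  exact Ideal.mem_span_singleton'.mpr ⟨q', hh'.symm⟩

/-- **A hypersurface over a DVR with non-zero reduction is torsion-free**: for `O` a DVR with
uniformizer `ϖ` and `G ∈ O[x_σ]` with `Ḡ ≠ 0`, no non-zero element of `O` kills a non-zero class of
`O[x_σ]/(G)`. [folklore] [OURS · L1 W4.5b] -/
theorem isTorsionFree_quotient_span_singleton_of_map_ne_zero [IsDomain O] [IsDiscreteValuationRing O]
    {ϖ : O} (hϖ : Irreducible ϖ) {G : MvPolynomial σ O}
    (hG : MvPolynomial.map (Ideal.Quotient.mk (Ideal.span {ϖ})) G ≠ 0) :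
    Module.IsTorsionFree O (MvPolynomial σ O ⧸ Ideal.span {G}) := by
  have hprime : (Ideal.span {ϖ}).IsPrime := (Ideal.span_singleton_prime hϖ.ne_zero).mpr hϖ.prime
  -- `ϖⁿ h ∈ (G) ⇒ h ∈ (G)`
  have hpow : ∀ (n : ℕ) (h : MvPolynomial σ O), C (ϖ ^ n) * h ∈ Ideal.span {G} →
      h ∈ Ideal.span {G} := by
    intro n
    induction n with
    | zero => intro h hh; simpa using hh
    | succ n ih =>
      intro h hh
      apply mem_span_singleton_of_C_mul_mem_of_map_ne_zero hprime hϖ.ne_zero hG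
      apply ih
      have e : C (ϖ ^ (n + 1)) * h = C (ϖ ^ n) * (C ϖ * h) := by
        rw [pow_succ, C_mul, mul_assoc]
      rw [e] at hh
      exact hh
  refine ⟨fun r hr => ?_⟩
  rw [isSMulRegular_iff_right_eq_zero_of_smul]
  intro m hm
  obtain ⟨h, rfl⟩ := Ideal.Quotient.mk_surjective m
  obtain ⟨n, v, rfl⟩ := IsDiscreteValuationRing.eq_unit_mul_pow_irreducible hr.ne_zero hϖ
  have hm2 : Ideal.Quotient.mk (Ideal.span {G}) (((v : O) * ϖ ^ n) • h) = 0 := hm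
  rw [smul_eq_C_mul, Ideal.Quotient.eq_zero_iff_mem, C_mul (a := (v : O)) (a' := ϖ ^ n),
    mul_assoc (C (v : O)) (C (ϖ ^ n)) h] at hm2
  have hm' : C (ϖ ^ n) * h ∈ Ideal.span {G} := by
    have h2 := Ideal.mul_mem_left _ (C ((v⁻¹ : Oˣ) : O)) hm2
    rwa [← mul_assoc, ← C_mul, Units.inv_mul, C_1, one_mul] at h2
  exact Ideal.Quotient.eq_zero_iff_mem.mpr (hpow n h hm')

/-- **A hypersurface over a DVR with non-zero reduction is flat**: for `O` a DVR with uniformizer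
`ϖ` and `G ∈ O[x_σ]` with `Ḡ ≠ 0`, `O[x_σ]/(G)` is flat over `O` (torsion-free over a Dedekind domain).
[folklore] [OURS · L1 W4.5b] -/
theorem flat_quotient_span_singleton_of_map_ne_zero [IsDomain O] [IsDiscreteValuationRing O]
    {ϖ : O} (hϖ : Irreducible ϖ) {G : MvPolynomial σ O}
    (hG : MvPolynomial.map (Ideal.Quotient.mk (Ideal.span {ϖ})) G ≠ 0) :
    Module.Flat O (MvPolynomial σ O ⧸ Ideal.span {G}) := by
  haveI := isTorsionFree_quotient_span_singleton_of_map_ne_zero hϖ hG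
  infer_instance

end FlatGeneral

end Summit.ResolutionOfSingularities.ResolutionOfSingularities.Cruxes.EquisingularLiftNat.Sections
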